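/-
Copyright (c) 2026. All rights reserved.
Released under Apache 2.0 license as described in the file LICENSE.
Authors: abc-iut cell, cone prover seat abc-iut-w6-d064 (wave W6, block C; abc-iut-L3-lead ruling α45 (1), co-split
«T54·E1b-transport» agreed with the T54·E1b holder abc-iut-w4-d048).
-/
import Literature.AnabelianGeometry.SemiGraphs.ChartFibreProfiniteCompletionTransport
import Literature.AnabelianGeometry.SemiGraphs.ProfiniteCompletionIndexFinite
import Literature.AnabelianGeometry.SemiGraphs.TemperedPiExistence
import Literature.AnabelianGeometry.SemiGraphs.TemperedCompletionRestrict
import HarnessLib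

/-!
# [SemiAnbd] Prop. 3.6 (iii) + Ex. 3.10: finiteness of the open subgroups of bounded index, and the cofinal
# characteristic family of open levels, TRANSPORTED from the profinite completion `π̂₁(𝒢)` to `π₁^temp(𝒢)`

Mochizuki, *Semi-graphs of anabelioids*, Publ. RIMS **42** (2006): Prop. 3.6 (iii) p. 38 ("The full
embedding `B(G) ↪ B^temp(G)` induces an injection `π₁^temp(G) ↪ π̂₁(G)`"), §3 p. 38 ("cofinal collection
of connected finite étale Galois coverings"), Ex. 3.10 p. 44 ("an exhaustive sequence of open characteristic
[hence normal] subgroups of finite index"), §5 Def. 5.1 (i) p. 62 / Prop. 5.2 (i) p. 63 (finiteness conditions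
of a continuous arithmetic action) [cite: MochizukiSemiAnbd2006, Prop 3.6(iii) p.38]; the group theory is
Dixon–du Sautoy–Mann–Segal, *Analytic pro-p groups* (2nd ed., 1999), Prop. 1.6 [cite: DixonEtAl1999, Prop 1.6].

PROOF-ONLY file (abc-iut cell, seat abc-iut-w6-d064; no definition, no named fact, no instance), the
`π₁^temp`-SIDE TRANSPORT half of the T54·E1b brick of the Thm. 5.4 (i) capstone (row T54-B of the cell's gap
ledger; L3-lead rulings α31/α45): abc-iut-w4-d048 proves, at the basepoint of `B(𝒢)` through a vertex
(`Aut (𝒢.fiberAt v₀)`, a model of `π̂₁(𝒢)`), that a FINITE connected graph of anabelioids with topologically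
finitely generated vertex groups has only finitely many open subgroups of each bounded index; THIS file
carries any such finiteness statement across the profinite-completion map to `π₁^temp(𝒢)` itself, where
abc-iut-L3-t9's Galois-tower constructor (`GaloisLevelData.ofGaloisSeq`) and the capstone binders
`hKst`/`hLst` consume it.

* §1 GENERIC, over the frozen predicate `IsProfiniteCompletion ι` (`ι : F → F̂`): the FINITENESS-CURRENCY
  variants of abc-iut-w4-d012's `ProfiniteCompletionIndexFinite` (p430642, whose hypothesis is topological
  finite generation of `F̂`): `finite_setOf_isOpen_index_of_finite` — if `F̂` has finitely many open subgroups
  of index `n ≠ 0`, so does `F`; `finite_openSubgroupsIndexLE_of_finite` — the same for abc-iut-w4-d053's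
  bounded-index sets `openSubgroupsIndexLE _ d`; and the characteristic-open-core corollaries
  `isOpen_charOpenCore_of_finite` / `finiteIndex_charOpenCore_of_finite` / `charOpenCore_family_of_finite`.
  The argument is d012's verbatim (`U ↦ cl ι(U)` is injective on open finite-index subgroups, abc-iut-w5-d139's
  `comap_topologicalClosure_map`, and preserves the index — the public `index_topologicalClosure_map_eq` of
  `TemperedCompletionRestrict.lean`, p424607).
* §2 AT THE TEMPERED CHART GROUP `c.G = π₁^temp(𝒢)` through a vertex `v` — completion map
  `isProfiniteCompletion_conjAut_chartActionFin` (abc-iut-L3-t7 lineage) into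
  `𝒢.toAnab.Pi v (ι ⋙ forget) = Aut (𝒢.fiberAt v)`: `finite_openSubgroupsIndexLE_chart_of_autFiberAt` (under a
  chart vertex datum and a verticial homomorphism at `v`) and `…_of_prop36` (under `Prop36Hypotheses`, the
  verticial homomorphism supplied by Thm. 3.7 (i) via `exists_isProfiniteCompletion_vertex`); the open-NORMAL
  (Galois-level) corollary `finite_openNormal_indexLE_chart_of_prop36`; and the cofinal characteristic family
  `charOpenCore_family_chart_of_prop36` of `π₁^temp(𝒢)` ([SemiAnbd] Ex. 3.10's "exhaustive sequence").
* §3 APPENDIX (the literal binder form of ruling α45 (1)): the same conclusions from the HONEST BINDER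
  `htfg : IsTopologicallyFinitelyGenerated (Aut Φ)` at the chart basepoint `Φ = chartFibreFin c _ hfin`
  (d012's theorems at `isProfiniteCompletion_chartActionFin(_of_prop36)`); nothing here proves `htfg`.

Classical; nothing here bears on [IUTchIII] Cor. 3.12; typed ≠ proved elsewhere; no side taken.
-/

noncomputable section

namespace Literature.AnabelianGeometry.SemiGraphs

open CategoryTheory
open Literature.AnabelianGeometry.AbsoluteAnabelian
open _root_.Topology

universe u v

/-! ## §1 Generic transport along a profinite-completion map (finiteness currency) -/

namespace IsProfiniteCompletion

variable {F : Type u} {Fhat : Type v} [Group F] [TopologicalSpace F] [IsTopologicalGroup F]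
  [Group Fhat] [TopologicalSpace Fhat] [IsTopologicalGroup Fhat] {ι : F →ₜ* Fhat}

/-- **Transport of «finitely many open subgroups of index `n`» from the completion.** If `ι : F → F̂` is
the profinite-completion map and `F̂` has only finitely many open subgroups of index `n ≠ 0`, then so has
`F`: `U ↦ cl ι(U)` is injective on open subgroups of index `n` (`ι⁻¹(cl ι(U)) = U`) with values among the
open subgroups of `F̂` of index `n` (`isOpen_topologicalClosure_map`, `index_topologicalClosure_map_eq` of p424607).
[cite: DixonEtAl1999, Prop 1.6] -/
theorem finite_setOf_isOpen_index_of_finite (hι : IsProfiniteCompletion ι) {n : ℕ} (hn : n ≠ 0)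
    (hT : {W : Subgroup Fhat | IsOpen (W : Set Fhat) ∧ W.index = n}.Finite) :
    {U : Subgroup F | IsOpen (U : Set F) ∧ U.index = n}.Finite := by
  let cl : Subgroup F → Subgroup Fhat := fun U => (U.map ι.toMonoidHom).topologicalClosure
  refine Set.Finite.of_finite_image (f := cl) (hT.subset ?_) ?_
  · rintro _ ⟨U, ⟨hUo, hUn⟩, rfl⟩
    haveI : U.FiniteIndex := ⟨by rw [hUn]; exact hn⟩
    exact ⟨isOpen_topologicalClosure_map hι U hUo, (index_topologicalClosure_map_eq hι U hUo).trans hUn⟩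
  · rintro U ⟨hUo, hUn⟩ U' ⟨hU'o, hU'n⟩ hUU'
    haveI : U.FiniteIndex := ⟨by rw [hUn]; exact hn⟩
    haveI : U'.FiniteIndex := ⟨by rw [hU'n]; exact hn⟩
    have h := comap_topologicalClosure_map hι U hUo
    have h' := comap_topologicalClosure_map hι U' hU'o
    have hc : (cl U).comap ι.toMonoidHom = (cl U').comap ι.toMonoidHom := by
      show ((U.map ι.toMonoidHom).topologicalClosure).comap ι.toMonoidHom =
        ((U'.map ι.toMonoidHom).topologicalClosure).comap ι.toMonoidHom
      exact congrArg (fun W : Subgroup Fhat => W.comap ι.toMonoidHom) hUU'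
    rw [h, h'] at hc
    exact hc

/-- **Bounded form**: if the completion `F̂` has only finitely many open subgroups of index `≤ d`
(abc-iut-w4-d053's `openSubgroupsIndexLE F̂ d` finite), then so has `F` (`openSubgroupsIndexLE F d` finite).
[cite: DixonEtAl1999, Prop 1.6] -/
theorem finite_openSubgroupsIndexLE_of_finite (hι : IsProfiniteCompletion ι) {d : ℕ}
    (hT : (openSubgroupsIndexLE Fhat d).Finite) : (openSubgroupsIndexLE F d).Finite := by
  have h : openSubgroupsIndexLE F d ⊆
      ⋃ n ∈ Finset.Icc 1 d, {U : Subgroup F | IsOpen (U : Set F) ∧ U.index = n} := by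
    rintro U ⟨hUo, hU0, hUd⟩
    refine Set.mem_biUnion (x := U.index) ?_ ⟨hUo, rfl⟩
    exact Finset.mem_Icc.mpr ⟨hU0, hUd⟩
  refine Set.Finite.subset ?_ h
  refine (Finset.Icc 1 d).finite_toSet.biUnion fun n hn => ?_
  have hn1 : 1 ≤ n := (Finset.mem_Icc.mp hn).1
  have hnd : n ≤ d := (Finset.mem_Icc.mp hn).2
  refine finite_setOf_isOpen_index_of_finite hι (Nat.pos_iff_ne_zero.mp hn1) (hT.subset ?_)
  rintro W ⟨hWo, hWn⟩
  exact ⟨hWo, by rw [hWn]; exact hn1, by rw [hWn]; exact hnd⟩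

/-- The characteristic open core `charOpenCore F d` is OPEN as soon as the completion has finitely many open
subgroups of index `≤ d` (abc-iut-w4-d053's `isOpen_charOpenCore` fed with the transported finiteness).
[cite: DixonEtAl1999, Prop 1.6] -/
theorem isOpen_charOpenCore_of_finite (hι : IsProfiniteCompletion ι) {d : ℕ}
    (hT : (openSubgroupsIndexLE Fhat d).Finite) : IsOpen (charOpenCore F d : Set F) :=
  isOpen_charOpenCore (finite_openSubgroupsIndexLE_of_finite hι hT)

/-- … and of FINITE INDEX (`charOpenCore_index_ne_zero`). [cite: DixonEtAl1999, Prop 1.6] -/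
theorem finiteIndex_charOpenCore_of_finite (hι : IsProfiniteCompletion ι) {d : ℕ}
    (hT : (openSubgroupsIndexLE Fhat d).Finite) : (charOpenCore F d).FiniteIndex :=
  Subgroup.finiteIndex_iff.mpr (charOpenCore_index_ne_zero (finite_openSubgroupsIndexLE_of_finite hι hT))

/-- **The cofinal characteristic family of `F` from finiteness on the completion** ([SemiAnbd] Ex. 3.10
p. 44, cofinal sense): if `F̂` has finitely many open subgroups of each bounded index, then
`n ↦ charOpenCore F n` is ANTITONE, each member is OPEN, NORMAL, of FINITE INDEX and FIXED by every
bi-continuous automorphism of `F`, and every open finite-index subgroup of `F` contains one of them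
(abc-iut-w4-d053's `charOpenCore_anti` / `charOpenCore_normal` / `map_charOpenCore_eq` /
`charOpenCore_le_of_finiteIndex`, openness and finite index from the transport).
[cite: MochizukiSemiAnbd2006, Ex 3.10 p.44] -/
theorem charOpenCore_family_of_finite (hι : IsProfiniteCompletion ι)
    (hT : ∀ d, (openSubgroupsIndexLE Fhat d).Finite) :
    Antitone (charOpenCore F) ∧
      (∀ n, IsOpen (charOpenCore F n : Set F) ∧ (charOpenCore F n).Normal ∧
        (charOpenCore F n).FiniteIndex ∧
        ∀ φ : MulAut F, Continuous φ → Continuous φ.symm →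
          (charOpenCore F n).map φ.toMonoidHom = charOpenCore F n) ∧
      ∀ U : Subgroup F, IsOpen (U : Set F) → U.FiniteIndex → ∃ n, charOpenCore F n ≤ U :=
  ⟨fun _ _ h => charOpenCore_anti h,
    fun n => ⟨isOpen_charOpenCore_of_finite hι (hT n), charOpenCore_normal n,
      finiteIndex_charOpenCore_of_finite hι (hT n), fun φ hφ hφ' => map_charOpenCore_eq φ hφ hφ'⟩,
    fun U hU _ => ⟨U.index, charOpenCore_le_of_finiteIndex U hU⟩⟩

end IsProfiniteCompletion

/-! ## §2 At the tempered chart group `π₁^temp(𝒢)` through a vertex (`π̂₁(𝒢) = Aut (𝒢.fiberAt v)`) -/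

namespace ProfiniteSemiGraph

variable {𝒢 : ProfiniteSemiGraph.{u}}

section Vertex

/-- **Transport to `π₁^temp(𝒢)` through a vertex** ([SemiAnbd] Prop. 3.6 (iii)): for a chart `c` with a
chart vertex datum `d` (Thm. 3.7 (i)) and a verticial homomorphism `ψ : Π_v → π₁^temp(𝒢)` with its defining
isomorphism `e` at the vertex `v`, the profinite completion of `c.G = π₁^temp(𝒢)` is `Aut (𝒢.fiberAt v)` (the
basepoint of `B(𝒢)` through `v`, `isProfiniteCompletion_conjAut_chartActionFin`); hence IF `Aut (𝒢.fiberAt v)`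
has only finitely many open subgroups of index `≤ B` (the T54·E1b finiteness, abc-iut-w4-d048: finite
semi-graph, topologically finitely generated vertex groups), THEN so has `π₁^temp(𝒢)`.
[cite: MochizukiSemiAnbd2006, Prop 3.6(iii) p.38] -/
theorem finite_openSubgroupsIndexLE_chart_of_autFiberAt (c : TemperedPiChart 𝒢)
    (h𝒢 : ∀ S : CovObj 𝒢, S.IsFinite → S.IsTempered) (d : ChartVertexDatum c) (v : 𝒢.graph.Vertex)
    (ψ : 𝒢.Gv v →ₜ* c.G) (e : c.equiv.inverse ⋙ ObjectProperty.ι _ ⋙ restrictV 𝒢 v ≅ BTemp.res ψ)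
    {B : ℕ} (hAut : (openSubgroupsIndexLE (Aut (𝒢.fiberAt v)) B).Finite) :
    (openSubgroupsIndexLE c.G B).Finite :=
  have hfin : ∀ X : 𝒢.toAnab.BObj, Finite ((chartFibre c h𝒢).obj X) :=
    fun X => finite_chartFibre c h𝒢 d.v d.ψ d.e X
  (isProfiniteCompletion_conjAut_chartActionFin c h𝒢 hfin d v ψ e).finite_openSubgroupsIndexLE_of_finite
    hAut

/-- Index-`n` form of the transport through a vertex: finitely many open subgroups of `Aut (𝒢.fiberAt v)` of
index `n ≠ 0` ⟹ finitely many open subgroups of `π₁^temp(𝒢)` of index `n`.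
[cite: MochizukiSemiAnbd2006, Prop 3.6(iii) p.38] -/
theorem finite_setOf_isOpen_index_chart_of_autFiberAt (c : TemperedPiChart 𝒢)
    (h𝒢 : ∀ S : CovObj 𝒢, S.IsFinite → S.IsTempered) (d : ChartVertexDatum c) (v : 𝒢.graph.Vertex)
    (ψ : 𝒢.Gv v →ₜ* c.G) (e : c.equiv.inverse ⋙ ObjectProperty.ι _ ⋙ restrictV 𝒢 v ≅ BTemp.res ψ)
    {n : ℕ} (hn : n ≠ 0)
    (hAut : {W : Subgroup (Aut (𝒢.fiberAt v)) |
      IsOpen (W : Set (Aut (𝒢.fiberAt v))) ∧ W.index = n}.Finite) :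
    {U : Subgroup c.G | IsOpen (U : Set c.G) ∧ U.index = n}.Finite :=
  have hfin : ∀ X : 𝒢.toAnab.BObj, Finite ((chartFibre c h𝒢).obj X) :=
    fun X => finite_chartFibre c h𝒢 d.v d.ψ d.e X
  (isProfiniteCompletion_conjAut_chartActionFin c h𝒢 hfin d v ψ e).finite_setOf_isOpen_index_of_finite
    hn hAut

end Vertex

section Prop36

/-- **Transport to `π₁^temp(𝒢)` under `Prop36Hypotheses`** (the verticial homomorphism at `v` and the
finiteness witness come from Thm. 3.7 (i), `exists_isProfiniteCompletion_vertex`): if `Aut (𝒢.fiberAt v)` has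
finitely many open subgroups of index `≤ B`, so has `c.G = π₁^temp(𝒢)` — «for every `B`, the open levels of
`π₁^temp(𝒢)` of index `≤ B` are finitely many». [cite: MochizukiSemiAnbd2006, Prop 3.6(iii) p.38] -/
theorem finite_openSubgroupsIndexLE_chart_of_autFiberAt_of_prop36 (h36 : 𝒢.Prop36Hypotheses)
    (c : TemperedPiChart 𝒢) (v : 𝒢.graph.Vertex) {B : ℕ}
    (hAut : (openSubgroupsIndexLE (Aut (𝒢.fiberAt v)) B).Finite) :
    (openSubgroupsIndexLE c.G B).Finite := by
  obtain ⟨ψ, e, hfin, hι⟩ := exists_isProfiniteCompletion_vertex h36 c v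
  exact hι.finite_openSubgroupsIndexLE_of_finite hAut

/-- Index-`n` form under `Prop36Hypotheses`: finitely many open subgroups of `Aut (𝒢.fiberAt v)` of index
`n ≠ 0` ⟹ finitely many open subgroups of `π₁^temp(𝒢)` of index `n`.
[cite: MochizukiSemiAnbd2006, Prop 3.6(iii) p.38] -/
theorem finite_setOf_isOpen_index_chart_of_autFiberAt_of_prop36 (h36 : 𝒢.Prop36Hypotheses)
    (c : TemperedPiChart 𝒢) (v : 𝒢.graph.Vertex) {n : ℕ} (hn : n ≠ 0)
    (hAut : {W : Subgroup (Aut (𝒢.fiberAt v)) |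
      IsOpen (W : Set (Aut (𝒢.fiberAt v))) ∧ W.index = n}.Finite) :
    {U : Subgroup c.G | IsOpen (U : Set c.G) ∧ U.index = n}.Finite := by
  obtain ⟨ψ, e, hfin, hι⟩ := exists_isProfiniteCompletion_vertex h36 c v
  exact hι.finite_setOf_isOpen_index_of_finite hn hAut

/-- **Galois levels of bounded index are finitely many** ([SemiAnbd] §3 p. 38 "cofinal collection of
connected finite étale Galois coverings", group-theoretically the open NORMAL subgroups of finite index):
under `Prop36Hypotheses`, if `Aut (𝒢.fiberAt v)` has finitely many open subgroups of index `≤ B`, then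
`{N ≤ π₁^temp(𝒢) | open, normal, 0 < index ≤ B}` is finite. [cite: MochizukiSemiAnbd2006, Prop 3.6 p.38] -/
theorem finite_openNormal_indexLE_chart_of_prop36 (h36 : 𝒢.Prop36Hypotheses) (c : TemperedPiChart 𝒢)
    (v : 𝒢.graph.Vertex) {B : ℕ} (hAut : (openSubgroupsIndexLE (Aut (𝒢.fiberAt v)) B).Finite) :
    {N : Subgroup c.G | IsOpen (N : Set c.G) ∧ N.Normal ∧ 0 < N.index ∧ N.index ≤ B}.Finite :=
  (finite_openSubgroupsIndexLE_chart_of_autFiberAt_of_prop36 h36 c v hAut).subset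
    fun _ hN => ⟨hN.1, hN.2.2.1, hN.2.2.2⟩

/-- The characteristic open cores of `π₁^temp(𝒢)` are OPEN, under `Prop36Hypotheses` and the finiteness at
`Aut (𝒢.fiberAt v)`. [cite: MochizukiSemiAnbd2006, Ex 3.10 p.44] -/
theorem isOpen_charOpenCore_chart_of_prop36 (h36 : 𝒢.Prop36Hypotheses) (c : TemperedPiChart 𝒢)
    (v : 𝒢.graph.Vertex) {d : ℕ} (hAut : (openSubgroupsIndexLE (Aut (𝒢.fiberAt v)) d).Finite) :
    IsOpen (charOpenCore c.G d : Set c.G) :=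
  isOpen_charOpenCore (finite_openSubgroupsIndexLE_chart_of_autFiberAt_of_prop36 h36 c v hAut)

/-- … and of FINITE INDEX. [cite: MochizukiSemiAnbd2006, Ex 3.10 p.44] -/
theorem finiteIndex_charOpenCore_chart_of_prop36 (h36 : 𝒢.Prop36Hypotheses) (c : TemperedPiChart 𝒢)
    (v : 𝒢.graph.Vertex) {d : ℕ} (hAut : (openSubgroupsIndexLE (Aut (𝒢.fiberAt v)) d).Finite) :
    (charOpenCore c.G d).FiniteIndex :=
  Subgroup.finiteIndex_iff.mpr
    (charOpenCore_index_ne_zero (finite_openSubgroupsIndexLE_chart_of_autFiberAt_of_prop36 h36 c v hAut))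

/-- **The cofinal characteristic family of open levels of `π₁^temp(𝒢)`** ([SemiAnbd] Ex. 3.10 p. 44 "an
exhaustive sequence of open characteristic [hence normal] subgroups of finite index", cofinal sense), under
`Prop36Hypotheses`, from finiteness of the open subgroups of each bounded index of `Aut (𝒢.fiberAt v)`
(T54·E1b): `n ↦ charOpenCore c.G n` is ANTITONE, each member OPEN, NORMAL, of FINITE INDEX, FIXED by every
bi-continuous automorphism of `π₁^temp(𝒢)` (in particular by every `Φ e`, `e ∈ π₁^temp(𝒢) ⋊^out Π_A`,
abc-iut-w4-d053's `charOpenCore_stable_outerSemidirectProduct`), and cofinal among the open finite-index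
subgroups — the level shape abc-iut-L3-t9's `GaloisLevelData.ofGaloisSeq` / the capstone binders `hKst`/`hLst`
consume. [cite: MochizukiSemiAnbd2006, Ex 3.10 p.44] -/
theorem charOpenCore_family_chart_of_prop36 (h36 : 𝒢.Prop36Hypotheses) (c : TemperedPiChart 𝒢)
    (v : 𝒢.graph.Vertex) (hAut : ∀ d, (openSubgroupsIndexLE (Aut (𝒢.fiberAt v)) d).Finite) :
    Antitone (charOpenCore c.G) ∧
      (∀ n, IsOpen (charOpenCore c.G n : Set c.G) ∧ (charOpenCore c.G n).Normal ∧
        (charOpenCore c.G n).FiniteIndex ∧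
        ∀ φ : MulAut c.G, Continuous φ → Continuous φ.symm →
          (charOpenCore c.G n).map φ.toMonoidHom = charOpenCore c.G n) ∧
      ∀ U : Subgroup c.G, IsOpen (U : Set c.G) → U.FiniteIndex → ∃ n, charOpenCore c.G n ≤ U := by
  obtain ⟨ψ, e, hfin, hι⟩ := exists_isProfiniteCompletion_vertex h36 c v
  exact hι.charOpenCore_family_of_finite hAut

end Prop36

/-! ## §3 Appendix — the literal binder form of ruling α45 (1): `htfg` on the chart basepoint `Aut Φ` -/

section Htfg

variable (c : TemperedPiChart 𝒢) (h𝒢 : ∀ S : CovObj 𝒢, S.IsFinite → S.IsTempered)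
  (hfin : ∀ X : 𝒢.toAnab.BObj, Finite ((chartFibre c h𝒢).obj X))

/-- Binder form (chart vertex datum): IF the chart basepoint's automorphism group `Aut Φ = π̂₁(𝒢)` is
topologically finitely generated (`htfg`, NOT proved here), then `openSubgroupsIndexLE c.G B` is finite for
every `B` (abc-iut-w4-d012's `finite_openSubgroupsIndexLE` at `isProfiniteCompletion_chartActionFin`).
[cite: MochizukiSemiAnbd2006, Prop 3.6(iii) p.38] -/
theorem finite_openSubgroupsIndexLE_chart_of_tfg (d : ChartVertexDatum c)
    (htfg : IsTopologicallyFinitelyGenerated (Aut (chartFibreFin c h𝒢 hfin))) (B : ℕ) :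
    (openSubgroupsIndexLE c.G B).Finite :=
  (isProfiniteCompletion_chartActionFin c h𝒢 hfin d).finite_openSubgroupsIndexLE htfg B

/-- Binder form (chart vertex datum): the cofinal characteristic family of `π₁^temp(𝒢)` from `htfg`
(abc-iut-w4-d012's `charOpenCore_family_of_completion` at the chart's completion map).
[cite: MochizukiSemiAnbd2006, Ex 3.10 p.44] -/
theorem charOpenCore_family_chart_of_tfg (d : ChartVertexDatum c)
    (htfg : IsTopologicallyFinitelyGenerated (Aut (chartFibreFin c h𝒢 hfin))) :
    Antitone (charOpenCore c.G) ∧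
      (∀ n, IsOpen (charOpenCore c.G n : Set c.G) ∧ (charOpenCore c.G n).Normal ∧
        (charOpenCore c.G n).FiniteIndex ∧
        ∀ φ : MulAut c.G, Continuous φ → Continuous φ.symm →
          (charOpenCore c.G n).map φ.toMonoidHom = charOpenCore c.G n) ∧
      ∀ U : Subgroup c.G, IsOpen (U : Set c.G) → U.FiniteIndex → ∃ n, charOpenCore c.G n ≤ U :=
  (isProfiniteCompletion_chartActionFin c h𝒢 hfin d).charOpenCore_family_of_completion htfg

end Htfg

section HtfgProp36

variable (h36 : 𝒢.Prop36Hypotheses) (c : TemperedPiChart 𝒢)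
  (hfin : ∀ X : 𝒢.toAnab.BObj, Finite ((chartFibre c (isTempered_of_isFinite_of_prop36 h36)).obj X))

/-- Binder form under `Prop36Hypotheses`: `htfg` at the chart basepoint ⟹ `openSubgroupsIndexLE c.G B` finite
for every `B`. [cite: MochizukiSemiAnbd2006, Prop 3.6(iii) p.38] -/
theorem finite_openSubgroupsIndexLE_chart_of_tfg_of_prop36
    (htfg : IsTopologicallyFinitelyGenerated
      (Aut (chartFibreFin c (isTempered_of_isFinite_of_prop36 h36) hfin))) (B : ℕ) :
    (openSubgroupsIndexLE c.G B).Finite :=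
  (isProfiniteCompletion_chartActionFin_of_prop36 h36 c hfin).finite_openSubgroupsIndexLE htfg B

/-- Binder form under `Prop36Hypotheses`: the cofinal characteristic family of `π₁^temp(𝒢)` from `htfg`.
[cite: MochizukiSemiAnbd2006, Ex 3.10 p.44] -/
theorem charOpenCore_family_chart_of_tfg_of_prop36
    (htfg : IsTopologicallyFinitelyGenerated
      (Aut (chartFibreFin c (isTempered_of_isFinite_of_prop36 h36) hfin))) :
    Antitone (charOpenCore c.G) ∧
      (∀ n, IsOpen (charOpenCore c.G n : Set c.G) ∧ (charOpenCore c.G n).Normal ∧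
        (charOpenCore c.G n).FiniteIndex ∧
        ∀ φ : MulAut c.G, Continuous φ → Continuous φ.symm →
          (charOpenCore c.G n).map φ.toMonoidHom = charOpenCore c.G n) ∧
      ∀ U : Subgroup c.G, IsOpen (U : Set c.G) → U.FiniteIndex → ∃ n, charOpenCore c.G n ≤ U :=
  (isProfiniteCompletion_chartActionFin_of_prop36 h36 c hfin).charOpenCore_family_of_completion htfg

end HtfgProp36

end ProfiniteSemiGraph

end Literature.AnabelianGeometry.SemiGraphs

end
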